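import Summits.Schanuel.Schanuel.Theorems.SoloInformedX193SupplySum
import Summits.Schanuel.Schanuel.Theorems.SoloInformedRoyAdditiveDirichlet

/-!
# X193 kernel line, file F7d: numerics of the count

Solo seat `solo-Schanuel-informed`, X193 kernel programme (design note
`work/s213/X193-KERNEL-DESIGN.md`, Amendment A8). Pure real / `Nat.floor` / `Filter.atTop`
bookkeeping for the choices of the count of pen §7: `r = (2η)^{1/(ν-1)}`, the payment window
`V e = ⌊κ e⌋₊` (`κ = (1+r)/(2r)`), the entry bound `E₀ = ⌊c^{1/β} N₀^{(ν-1)/β}⌋₊`, `hbig` and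
`habs` of `supply_le` as eventual statements, the demand coefficient `K' - A₆ N₁^δ`, the
growth `O(N₀^{(1+a)δ} log² N₀)` of the supply constant, the endgame. No definitions, no sorries.
-/

namespace Summit.Schanuel.Schanuel.Theorems

open Filter

/-- `r^{ν-1} = 2η` exactly (`ν > 1`, `η ≥ 0`). -/
theorem soloX_ratio_rpow {η ν : ℝ} (hη : 0 ≤ η) (hν : 1 < ν) :
    ((2 * η) ^ (1 / (ν - 1))) ^ (ν - 1) = 2 * η := by
  rw [← Real.rpow_mul (by linarith), one_div, inv_mul_cancel₀ (sub_pos.mpr hν).ne',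
    Real.rpow_one]

/-- `r < 1` when `2η < 1` (`ν > 1`). -/
theorem soloX_ratio_lt_one {η ν : ℝ} (hη : 0 ≤ η) (h2η : 2 * η < 1) (hν : 1 < ν) :
    (2 * η) ^ (1 / (ν - 1)) < 1 :=
  Real.rpow_lt_one (by linarith) h2η (by rw [one_div]; exact inv_pos.mpr (sub_pos.mpr hν))

/-! ### The payment window `V e = ⌊κ e⌋₊`, `κ = (1+r)/(2r)`, `θ = κ - 1` -/

/-- `κ = (1+r)/(2r) > 1` for `0 < r < 1`. -/
theorem soloX_kappa_gt_one {r : ℝ} (hr : 0 < r) (hr1 : r < 1) : 1 < (1 + r) / (2 * r) := by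
  rw [lt_div_iff₀ (by linarith)]
  linarith

/-- Window facts of `V e = ⌊κ e⌋₊` (`κ ≥ 1`): `e ≤ V e`, `(κ-1) e ≤ V e + 1 - e`, `V e ≤ κ e`
(the shape of `supply_le`'s `hVwin` with `θ = κ - 1`). -/
theorem soloX_Vwin {κ : ℝ} (hκ : 1 ≤ κ) (e : ℕ) :
    e ≤ ⌊κ * e⌋₊ ∧ (κ - 1) * (e : ℝ) ≤ (⌊κ * e⌋₊ : ℝ) + 1 - e ∧ (⌊κ * e⌋₊ : ℝ) ≤ κ * e := by
  have he : (0 : ℝ) ≤ e := Nat.cast_nonneg e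
  have hκe : (e : ℝ) ≤ κ * e := by nlinarith
  have h0 : (0 : ℝ) ≤ κ * e := he.trans hκe
  refine ⟨Nat.le_floor hκe, ?_, Nat.floor_le h0⟩
  have := Nat.lt_floor_add_one (κ * (e : ℝ))
  linarith

/-- Witnessing levels lie beyond the window: if `((e-1 : ℕ) : ℝ) ≤ r n` (`good_window_upper`),
`0 < r < 1` and `2/(1-r) ≤ e`, then `⌊κ e⌋₊ ≤ n` for `κ = (1+r)/(2r)`. -/
theorem soloX_Vwit {r : ℝ} (hr : 0 < r) (hr1 : r < 1) {e n : ℕ} (he1 : 1 ≤ e)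
    (he : 2 / (1 - r) ≤ (e : ℝ)) (hwin : (((e - 1 : ℕ)) : ℝ) ≤ r * n) :
    ⌊(1 + r) / (2 * r) * e⌋₊ ≤ n := by
  have h1 : (((e - 1 : ℕ)) : ℝ) = (e : ℝ) - 1 := by rw [Nat.cast_sub he1, Nat.cast_one]
  rw [h1] at hwin
  have h3 : 2 ≤ (1 - r) * e := by
    rw [div_le_iff₀ (by linarith)] at he
    linarith
  have hκe : (1 + r) / (2 * r) * (e : ℝ) ≤ n := by
    rw [div_mul_eq_mul_div, div_le_iff₀ (by linarith)]
    have : (1 + r) * (e : ℝ) = 2 * e - (1 - r) * e := by ring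
    rw [this]
    nlinarith
  have h0 : (0 : ℝ) ≤ (1 + r) / (2 * r) * e := by positivity
  exact_mod_cast (Nat.floor_le h0).trans hκe

/-! ### The entry bound `E₀ = ⌊c^{1/β} N₀^{(ν-1)/β}⌋₊` -/

/-- `E₀^β ≤ c N₀^{ν-1}` for `E₀ = ⌊c^{1/β} N₀^{(ν-1)/β}⌋₊` (`c ≥ 0`, `β > 0`). -/
theorem soloX_E0_rpow_le {c β ν : ℝ} (hc : 0 ≤ c) (hβ : 0 < β) (N₀ : ℕ) :
    ((⌊c ^ (1 / β) * (N₀ : ℝ) ^ ((ν - 1) / β)⌋₊ : ℕ) : ℝ) ^ β ≤ c * (N₀ : ℝ) ^ (ν - 1) := by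
  have hN : (0 : ℝ) ≤ N₀ := Nat.cast_nonneg N₀
  have hx : 0 ≤ c ^ (1 / β) * (N₀ : ℝ) ^ ((ν - 1) / β) := by positivity
  have h1 : ((⌊c ^ (1 / β) * (N₀ : ℝ) ^ ((ν - 1) / β)⌋₊ : ℕ) : ℝ) ^ β ≤
      (c ^ (1 / β) * (N₀ : ℝ) ^ ((ν - 1) / β)) ^ β :=
    Real.rpow_le_rpow (Nat.cast_nonneg _) (Nat.floor_le hx) hβ.le
  have h2 : (c ^ (1 / β) * (N₀ : ℝ) ^ ((ν - 1) / β)) ^ β = c * (N₀ : ℝ) ^ (ν - 1) := by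
    rw [Real.mul_rpow (by positivity) (by positivity), ← Real.rpow_mul hc, ← Real.rpow_mul hN,
      one_div, inv_mul_cancel₀ hβ.ne', Real.rpow_one, div_mul_cancel₀ _ hβ.ne']
  rw [h2] at h1
  exact h1

/-- `E₀ ≤ N₀` when `c ≤ 1`, `(ν-1)/β ≤ 1` and `N₀ ≥ 1`. -/
theorem soloX_E0_le {c β ν : ℝ} (hc : 0 ≤ c) (hc1 : c ≤ 1) (hβ : 0 < β)
    (he1 : (ν - 1) / β ≤ 1) {N₀ : ℕ} (hN : 1 ≤ N₀) :
    ⌊c ^ (1 / β) * (N₀ : ℝ) ^ ((ν - 1) / β)⌋₊ ≤ N₀ := by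
  have hN' : (1 : ℝ) ≤ N₀ := by exact_mod_cast hN
  have h1 : c ^ (1 / β) ≤ 1 := Real.rpow_le_one hc hc1 (by positivity)
  have h2 : (N₀ : ℝ) ^ ((ν - 1) / β) ≤ N₀ := by
    calc (N₀ : ℝ) ^ ((ν - 1) / β) ≤ (N₀ : ℝ) ^ (1 : ℝ) :=
          Real.rpow_le_rpow_of_exponent_le hN' he1
      _ = N₀ := Real.rpow_one _
  have h3 : c ^ (1 / β) * (N₀ : ℝ) ^ ((ν - 1) / β) ≤ N₀ := by
    calc c ^ (1 / β) * (N₀ : ℝ) ^ ((ν - 1) / β) ≤ 1 * (N₀ : ℝ) ^ ((ν - 1) / β) :=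
          mul_le_mul_of_nonneg_right h1 (by positivity)
      _ ≤ N₀ := by rw [one_mul]; exact h2
  exact Nat.floor_le_of_le h3

/-- `E₀ → ∞`: `⌊c N₀^{e₀}⌋₊ → ∞` along `N₀ → ∞` for `c > 0`, `e₀ > 0`. -/
theorem soloX_E0_tendsto {c e₀ : ℝ} (hc : 0 < c) (he₀ : 0 < e₀) :
    Tendsto (fun N₀ : ℕ => ⌊c * (N₀ : ℝ) ^ e₀⌋₊) atTop atTop := by
  have h1 : Tendsto (fun N₀ : ℕ => (N₀ : ℝ) ^ e₀) atTop atTop :=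
    (tendsto_rpow_atTop he₀).comp tendsto_natCast_atTop_atTop
  exact tendsto_nat_floor_atTop.comp (h1.const_mul_atTop hc)

/-- Main term of `hbig`: if `1 ≤ E₀`, `E₀^β ≤ (λ/(8(1+b₁))) N₀^{ν-1}`, `β ≥ 1`, `ν ≥ 1` and
`1 ≤ N₀ ≤ n`, then `2 n (E₀^β + b₁ E₀) ≤ (λ/4) n^ν`. -/
theorem soloX_hbig_main {lam b₁ β ν : ℝ} (hlam : 0 < lam) (hb₁ : 0 ≤ b₁) (hβ : 1 ≤ β)
    (hν : 1 ≤ ν) {E₀ N₀ n : ℕ} (hE1 : 1 ≤ E₀)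
    (hE : ((E₀ : ℕ) : ℝ) ^ β ≤ lam / (8 * (1 + b₁)) * (N₀ : ℝ) ^ (ν - 1)) (hN : 1 ≤ N₀)
    (hn : N₀ ≤ n) :
    2 * (n : ℝ) * ((E₀ : ℝ) ^ β + b₁ * E₀) ≤ lam / 4 * (n : ℝ) ^ ν := by
  have hE1' : (1 : ℝ) ≤ E₀ := by exact_mod_cast hE1
  have hn0 : (0 : ℝ) < n := by exact_mod_cast lt_of_lt_of_le (by omega : 0 < N₀) hn
  have hNn : (N₀ : ℝ) ≤ n := by exact_mod_cast hn
  have hself : (E₀ : ℝ) ≤ (E₀ : ℝ) ^ β := Real.self_le_rpow_of_one_le hE1' hβ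
  have hpow : (N₀ : ℝ) ^ (ν - 1) ≤ (n : ℝ) ^ (ν - 1) :=
    Real.rpow_le_rpow (Nat.cast_nonneg _) hNn (by linarith)
  have h1b : (0 : ℝ) < 1 + b₁ := by linarith
  have hsum : (E₀ : ℝ) ^ β + b₁ * E₀ ≤ (1 + b₁) * (E₀ : ℝ) ^ β := by
    nlinarith [mul_le_mul_of_nonneg_left hself hb₁]
  have hmain : (1 + b₁) * (E₀ : ℝ) ^ β ≤ lam / 8 * (n : ℝ) ^ (ν - 1) := by
    calc (1 + b₁) * (E₀ : ℝ) ^ β ≤ (1 + b₁) * (lam / (8 * (1 + b₁)) * (N₀ : ℝ) ^ (ν - 1)) :=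
          mul_le_mul_of_nonneg_left hE h1b.le
      _ = lam / 8 * (N₀ : ℝ) ^ (ν - 1) := by field_simp
      _ ≤ lam / 8 * (n : ℝ) ^ (ν - 1) := mul_le_mul_of_nonneg_left hpow (by positivity)
  have hνsplit : (n : ℝ) ^ ν = (n : ℝ) ^ (ν - 1) * n := by
    rw [← Real.rpow_add_one hn0.ne', sub_add_cancel]
  rw [hνsplit]
  nlinarith [hsum, hmain, hn0, Real.rpow_nonneg hn0.le (ν - 1)]

/-! ### Logarithmic tails: `hbig` and `habs` eventually -/

/-- `log (n + 2) ≤ 3 n^ε / ε` for `n ≥ 1`, `0 < ε ≤ 1`. -/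
theorem soloX_log_add_two_le {n : ℕ} (hn : 1 ≤ n) {ε : ℝ} (hε : 0 < ε) (hε1 : ε ≤ 1) :
    Real.log ((n : ℝ) + 2) ≤ 3 * (n : ℝ) ^ ε / ε := by
  have hn' : (1 : ℝ) ≤ n := by exact_mod_cast hn
  have h1 : Real.log ((n : ℝ) + 2) ≤ ((n : ℝ) + 2) ^ ε / ε :=
    Real.log_le_rpow_div (by positivity) hε
  have h2 : ((n : ℝ) + 2) ^ ε ≤ (3 * (n : ℝ)) ^ ε :=
    Real.rpow_le_rpow (by positivity) (by linarith) hε.le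
  have h3 : (3 * (n : ℝ)) ^ ε = (3 : ℝ) ^ ε * (n : ℝ) ^ ε :=
    Real.mul_rpow (by norm_num) (by positivity)
  have h4 : (3 : ℝ) ^ ε ≤ 3 := by
    calc (3 : ℝ) ^ ε ≤ (3 : ℝ) ^ (1 : ℝ) := Real.rpow_le_rpow_of_exponent_le (by norm_num) hε1
      _ = 3 := Real.rpow_one 3
  have h5 : ((n : ℝ) + 2) ^ ε ≤ 3 * (n : ℝ) ^ ε := by
    rw [h3] at h2
    exact h2.trans (mul_le_mul_of_nonneg_right h4 (Real.rpow_nonneg (by positivity) _))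
  calc Real.log ((n : ℝ) + 2) ≤ ((n : ℝ) + 2) ^ ε / ε := h1
    _ ≤ 3 * (n : ℝ) ^ ε / ε := by gcongr

/-- Tail of `hbig`: for `ν > 2`, `B ≥ 0`, `λ > 0`, eventually `B n² log (n+2) ≤ (λ/4) n^ν`. -/
theorem soloX_hbig_tail {B lam ν : ℝ} (hB : 0 ≤ B) (hlam : 0 < lam) (hν : 2 < ν) :
    ∀ᶠ n : ℕ in atTop,
      B * (n : ℝ) ^ 2 * Real.log ((n : ℝ) + 2) ≤ lam / 4 * (n : ℝ) ^ ν := by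
  obtain ⟨ε, hε, hε1, hε2⟩ : ∃ ε : ℝ, 0 < ε ∧ ε ≤ 1 ∧ 2 + ε < ν :=
    ⟨min 1 ((ν - 2) / 2), lt_min one_pos (by linarith), min_le_left _ _,
      by have := min_le_right 1 ((ν - 2) / 2); linarith⟩
  have hcc : lam / 4 * (4 / lam) = 1 := by
    rw [div_mul_div_comm, mul_comm lam 4, div_self (by positivity)]
  filter_upwards [eventually_const_mul_rpow_le_rpow hε2 (3 * B / ε * (4 / lam)),
    eventually_ge_atTop 1] with n hC hn
  have hn0 : (0 : ℝ) < n := by exact_mod_cast hn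
  have hsq : (n : ℝ) ^ (2 + ε) = (n : ℝ) ^ 2 * (n : ℝ) ^ ε := by
    rw [Real.rpow_add hn0, Real.rpow_two]
  have h1 : B * (n : ℝ) ^ 2 * Real.log ((n : ℝ) + 2) ≤
      B * (n : ℝ) ^ 2 * (3 * (n : ℝ) ^ ε / ε) :=
    mul_le_mul_of_nonneg_left (soloX_log_add_two_le hn hε hε1) (by positivity)
  have h2 : B * (n : ℝ) ^ 2 * (3 * (n : ℝ) ^ ε / ε) = 3 * B / ε * (n : ℝ) ^ (2 + ε) := by
    rw [hsq]; ring
  have h3 : 3 * B / ε * (n : ℝ) ^ (2 + ε) ≤ lam / 4 * (n : ℝ) ^ ν := by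
    have h := mul_le_mul_of_nonneg_left hC (by positivity : (0 : ℝ) ≤ lam / 4)
    calc 3 * B / ε * (n : ℝ) ^ (2 + ε)
        = (lam / 4 * (4 / lam)) * (3 * B / ε * (n : ℝ) ^ (2 + ε)) := by rw [hcc, one_mul]
      _ = lam / 4 * (3 * B / ε * (4 / lam) * (n : ℝ) ^ (2 + ε)) := by ring
      _ ≤ lam / 4 * (n : ℝ) ^ ν := h
  linarith [h1, h2, h3]

/-- `hbig` at all levels `n ≥ N₀`, eventually in `N₀` (`soloX_hbig_main` + `soloX_hbig_tail`):
if `1 ≤ E₀` and `E₀^β ≤ (λ/(8(1+b₁))) N₀^{ν-1}` then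
`2 n (E₀^β + b₁ E₀) + B n² log (n+2) < λ n^ν` for every `n ≥ N₀`. -/
theorem soloX_hbig_eventually {lam b₁ B β ν : ℝ} (hlam : 0 < lam) (hb₁ : 0 ≤ b₁)
    (hB : 0 ≤ B) (hβ : 1 ≤ β) (hν : 2 < ν) :
    ∀ᶠ N₀ : ℕ in atTop, ∀ E₀ : ℕ, 1 ≤ E₀ →
      ((E₀ : ℕ) : ℝ) ^ β ≤ lam / (8 * (1 + b₁)) * (N₀ : ℝ) ^ (ν - 1) →
      ∀ n : ℕ, N₀ ≤ n → 2 * n * ((E₀ : ℝ) ^ β + b₁ * E₀) +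
        B * (n : ℝ) ^ 2 * Real.log ((n : ℝ) + 2) < lam * (n : ℝ) ^ ν := by
  filter_upwards [eventually_forall_ge_atTop.mpr (soloX_hbig_tail hB hlam hν),
    eventually_ge_atTop 1] with N₀ htail hN E₀ hE1 hE n hn
  have hn0 : (0 : ℝ) < n := by exact_mod_cast lt_of_lt_of_le (by omega : 0 < N₀) hn
  have hmain := soloX_hbig_main hlam hb₁ hβ (by linarith) hE1 hE hN hn
  have ht := htail n hn
  have hpos : 0 < lam * (n : ℝ) ^ ν := mul_pos hlam (Real.rpow_pos_of_pos hn0 ν)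
  linarith

/-- Tail of `habs`: for `β > 2`, `A₂ ≥ 0`, eventually `16 A₂ ℓ^{2-β} log (ℓ+2) ≤ 1`. -/
theorem soloX_habs_tail {A₂ β : ℝ} (hA₂ : 0 ≤ A₂) (hβ : 2 < β) :
    ∀ᶠ ℓ : ℕ in atTop, 16 * A₂ * (ℓ : ℝ) ^ (2 - β) * Real.log ((ℓ : ℝ) + 2) ≤ 1 := by
  obtain ⟨ε, hε, hε1, hε2⟩ : ∃ ε : ℝ, 0 < ε ∧ ε ≤ 1 ∧ 2 - β + ε < 0 :=
    ⟨min 1 ((β - 2) / 2), lt_min one_pos (by linarith), min_le_left _ _,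
      by have := min_le_right 1 ((β - 2) / 2); linarith⟩
  filter_upwards [eventually_const_mul_rpow_le_rpow hε2 (48 * A₂ / ε),
    eventually_ge_atTop 1] with ℓ hC hℓ
  have hℓ0 : (0 : ℝ) < ℓ := by exact_mod_cast hℓ
  rw [Real.rpow_zero] at hC
  have hprod : (ℓ : ℝ) ^ (2 - β + ε) = (ℓ : ℝ) ^ (2 - β) * (ℓ : ℝ) ^ ε :=
    Real.rpow_add hℓ0 _ _
  have h1 : 16 * A₂ * (ℓ : ℝ) ^ (2 - β) * Real.log ((ℓ : ℝ) + 2) ≤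
      16 * A₂ * (ℓ : ℝ) ^ (2 - β) * (3 * (ℓ : ℝ) ^ ε / ε) :=
    mul_le_mul_of_nonneg_left (soloX_log_add_two_le hℓ hε hε1) (by positivity)
  have h2 : 16 * A₂ * (ℓ : ℝ) ^ (2 - β) * (3 * (ℓ : ℝ) ^ ε / ε) =
      48 * A₂ / ε * (ℓ : ℝ) ^ (2 - β + ε) := by
    rw [hprod]; ring
  linarith [h1, h2, hC]

/-- Entry-bound thresholds, eventually in `N₀`: for `c > 0`, `e₀ > 0`, the bound
`E₀ = ⌊c N₀^{e₀}⌋₊` eventually exceeds any `m : ℕ` and any `x : ℝ`, and any property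
holding eventually in `ℓ` eventually holds at all `ℓ ≥ E₀` (used with `soloX_habs_tail`). -/
theorem soloX_E0_eventually {c e₀ : ℝ} (hc : 0 < c) (he₀ : 0 < e₀) (m : ℕ) (x : ℝ)
    {p : ℕ → Prop} (hp : ∀ᶠ ℓ : ℕ in atTop, p ℓ) :
    ∀ᶠ N₀ : ℕ in atTop, m ≤ ⌊c * (N₀ : ℝ) ^ e₀⌋₊ ∧ x ≤ ((⌊c * (N₀ : ℝ) ^ e₀⌋₊ : ℕ) : ℝ) ∧
      ∀ ℓ : ℕ, ⌊c * (N₀ : ℝ) ^ e₀⌋₊ ≤ ℓ → p ℓ := by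
  have hT := soloX_E0_tendsto hc he₀
  have hT' : Tendsto (fun N₀ : ℕ => ((⌊c * (N₀ : ℝ) ^ e₀⌋₊ : ℕ) : ℝ)) atTop atTop :=
    tendsto_natCast_atTop_atTop.comp hT
  filter_upwards [hT.eventually_ge_atTop m, hT'.eventually_ge_atTop x,
    hT.eventually_forall_ge_atTop hp] with N₀ h1 h2 h3
  exact ⟨h1, h2, h3⟩

/-- Demand coefficient, eventually in `N₀`: with `E₀ = ⌊c N₀^{e₀}⌋₊`, `K' = ⌊E₀^σ⌋₊`,
`N₁ = ⌊N₀^{1+a}⌋₊` and `(1+a) δ < e₀ σ`, eventually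
`((c/2)^σ / 2) N₀^{e₀ σ} ≤ K' - A₆ N₁^δ`. -/
theorem soloX_demand_coeff {c e₀ σ a δ A₆ : ℝ} (hc : 0 < c) (he₀ : 0 < e₀) (hσ : 0 < σ)
    (hδ : 0 ≤ δ) (hA₆ : 0 ≤ A₆) (hq : (1 + a) * δ < e₀ * σ) :
    ∀ᶠ N₀ : ℕ in atTop,
      (c / 2) ^ σ / 2 * (N₀ : ℝ) ^ (e₀ * σ) ≤
        (⌊((⌊c * (N₀ : ℝ) ^ e₀⌋₊ : ℕ) : ℝ) ^ σ⌋₊ : ℝ) -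
          A₆ * ((⌊(N₀ : ℝ) ^ (1 + a)⌋₊ : ℕ) : ℝ) ^ δ := by
  have hcσ : 0 < (c / 2) ^ σ := Real.rpow_pos_of_pos (by positivity) σ
  have hp : 0 < e₀ * σ := mul_pos he₀ hσ
  have hT : Tendsto (fun N₀ : ℕ => c * (N₀ : ℝ) ^ e₀) atTop atTop :=
    ((tendsto_rpow_atTop he₀).comp tendsto_natCast_atTop_atTop).const_mul_atTop hc
  filter_upwards [hT.eventually_ge_atTop 2,
    eventually_const_mul_rpow_le_rpow hq (4 * A₆ / (c / 2) ^ σ),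
    eventually_const_mul_rpow_le_rpow hp (4 / (c / 2) ^ σ)] with N₀ h2 hA hX
  have hN : (0 : ℝ) ≤ N₀ := Nat.cast_nonneg N₀
  rw [Real.rpow_zero, mul_one, div_le_iff₀ hcσ] at hX
  rw [div_mul_eq_mul_div, div_le_iff₀ hcσ] at hA
  -- E₀ ≥ (c/2) N₀^{e₀}
  have hE := Nat.lt_floor_add_one (c * (N₀ : ℝ) ^ e₀)
  generalize ⌊c * (N₀ : ℝ) ^ e₀⌋₊ = E₀ at hE ⊢
  have hE' : c / 2 * (N₀ : ℝ) ^ e₀ ≤ E₀ := by linarith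
  have hEσ : (c / 2) ^ σ * (N₀ : ℝ) ^ (e₀ * σ) ≤ (E₀ : ℝ) ^ σ := by
    calc (c / 2) ^ σ * (N₀ : ℝ) ^ (e₀ * σ) = (c / 2 * (N₀ : ℝ) ^ e₀) ^ σ := by
          rw [Real.mul_rpow (by positivity) (by positivity), Real.rpow_mul hN]
      _ ≤ (E₀ : ℝ) ^ σ := Real.rpow_le_rpow (by positivity) hE' hσ.le
  -- K' ≥ E₀^σ - 1
  have hK := Nat.lt_floor_add_one ((E₀ : ℝ) ^ σ)
  generalize ⌊(E₀ : ℝ) ^ σ⌋₊ = K at hK ⊢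
  -- N₁^δ ≤ N₀^{(1+a)δ}
  have hN₁ := Nat.floor_le (Real.rpow_nonneg hN (1 + a))
  generalize ⌊(N₀ : ℝ) ^ (1 + a)⌋₊ = N₁ at hN₁ ⊢
  have hN₁δ : (N₁ : ℝ) ^ δ ≤ (N₀ : ℝ) ^ ((1 + a) * δ) := by
    calc (N₁ : ℝ) ^ δ ≤ ((N₀ : ℝ) ^ (1 + a)) ^ δ :=
          Real.rpow_le_rpow (Nat.cast_nonneg _) hN₁ hδ
      _ = (N₀ : ℝ) ^ ((1 + a) * δ) := by rw [← Real.rpow_mul hN]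
  have hAN : A₆ * (N₁ : ℝ) ^ δ ≤ A₆ * (N₀ : ℝ) ^ ((1 + a) * δ) :=
    mul_le_mul_of_nonneg_left hN₁δ hA₆
  nlinarith [hEσ, hK, hAN, hA, hX, hcσ]

/-- The supply constant of `supply_le` is `O(N₀^{(1+a)δ} log² N₀)`: for
`3 ≤ N₀ ≤ N₁ ≤ N₀^{1+a}`, `E₀ + 1 ≤ N₁` and `M = N₁ + 2`, it is at most
`C_S N₀^{(1+a)δ} (log N₀)²` with
`C_S = (3+β+2b₁+B+δ) 2^{1+β} 3^δ (κ^{β+1}/θ) ((2+b₁) 2) (2+a)²`. -/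
theorem soloX_supply_upper {β b₁ B δ θ κ a : ℝ} (hβ : 0 ≤ β) (hb₁ : 0 ≤ b₁) (hB : 0 ≤ B)
    (hδ : 0 ≤ δ) (hθ : 0 < θ) (hκ : 1 ≤ κ) (ha : 0 ≤ a) {N₀ N₁ E₀ : ℕ} (hN₀ : 3 ≤ N₀)
    (hN : N₀ ≤ N₁) (hN₁ : (N₁ : ℝ) ≤ (N₀ : ℝ) ^ (1 + a)) (hEN : E₀ + 1 ≤ N₁) :
    (3 + β + 2 * b₁ + (B + δ) * Real.log ((N₁ : ℝ) + 2)) *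
        (2 ^ (1 + β) * ((N₁ : ℝ) + 2) ^ δ) * (κ ^ (β + 1) / θ) *
        ((2 + b₁) * (1 / ((E₀ + 1 : ℕ) : ℝ) + Real.log ((N₁ : ℝ) / ((E₀ + 1 : ℕ) : ℝ)))) ≤
      (3 + β + 2 * b₁ + B + δ) * 2 ^ (1 + β) * 3 ^ δ * (κ ^ (β + 1) / θ) *
        ((2 + b₁) * 2) * (2 + a) ^ 2 * (N₀ : ℝ) ^ ((1 + a) * δ) * Real.log N₀ ^ 2 := by
  have hN₀' : (3 : ℝ) ≤ N₀ := by exact_mod_cast hN₀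
  have hN₁' : (3 : ℝ) ≤ N₁ := by exact_mod_cast hN₀.trans hN
  have hN₁0 : (0 : ℝ) < N₁ := by linarith
  have hM3 : (3 : ℝ) ≤ (N₁ : ℝ) + 2 := by linarith
  have hM0 : (0 : ℝ) < (N₁ : ℝ) + 2 := by linarith
  have hlog3 : 1 ≤ Real.log 3 := by
    have h : Real.exp 1 < 3 := lt_trans Real.exp_one_lt_d9 (by norm_num)
    exact ((Real.lt_log_iff_exp_lt (by norm_num)).mpr h).le
  have hL3 : Real.log 3 ≤ Real.log N₀ := Real.log_le_log (by norm_num) hN₀'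
  have hlogM1 : 1 ≤ Real.log ((N₁ : ℝ) + 2) :=
    hlog3.trans (Real.log_le_log (by norm_num) hM3)
  have hP1 : 1 ≤ (N₀ : ℝ) ^ (1 + a) := Real.one_le_rpow (by linarith) (by linarith)
  have hMle : (N₁ : ℝ) + 2 ≤ 3 * (N₀ : ℝ) ^ (1 + a) := by linarith
  -- log M ≤ (2 + a) log N₀
  have hlogM : Real.log ((N₁ : ℝ) + 2) ≤ (2 + a) * Real.log N₀ := by
    have h1 : Real.log ((N₁ : ℝ) + 2) ≤ Real.log (3 * (N₀ : ℝ) ^ (1 + a)) :=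
      Real.log_le_log hM0 hMle
    have h2 : Real.log (3 * (N₀ : ℝ) ^ (1 + a)) = Real.log 3 + (1 + a) * Real.log N₀ := by
      rw [Real.log_mul (by norm_num) (by positivity), Real.log_rpow (by linarith)]
    rw [h2] at h1
    linarith
  -- the four factors
  have hH : 3 + β + 2 * b₁ + (B + δ) * Real.log ((N₁ : ℝ) + 2) ≤
      (3 + β + 2 * b₁ + B + δ) * Real.log ((N₁ : ℝ) + 2) := by
    nlinarith [hlogM1]
  have hH0 : 0 ≤ 3 + β + 2 * b₁ + (B + δ) * Real.log ((N₁ : ℝ) + 2) := by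
    have := mul_nonneg (add_nonneg hB hδ) (le_trans zero_le_one hlogM1)
    linarith
  have hMδ : (2 : ℝ) ^ (1 + β) * ((N₁ : ℝ) + 2) ^ δ ≤
      (2 : ℝ) ^ (1 + β) * ((3 : ℝ) ^ δ * (N₀ : ℝ) ^ ((1 + a) * δ)) := by
    refine mul_le_mul_of_nonneg_left ?_ (by positivity)
    calc ((N₁ : ℝ) + 2) ^ δ ≤ (3 * (N₀ : ℝ) ^ (1 + a)) ^ δ :=
          Real.rpow_le_rpow hM0.le hMle hδ
      _ = (3 : ℝ) ^ δ * (N₀ : ℝ) ^ ((1 + a) * δ) := by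
        rw [Real.mul_rpow (by norm_num) (by positivity), ← Real.rpow_mul (by positivity)]
  have hκθ : 0 ≤ κ ^ (β + 1) / θ := (div_pos (Real.rpow_pos_of_pos (by linarith) _) hθ).le
  have hE1 : (1 : ℝ) ≤ ((E₀ + 1 : ℕ) : ℝ) := by exact_mod_cast Nat.le_add_left 1 E₀
  have hEN' : ((E₀ + 1 : ℕ) : ℝ) ≤ N₁ := by exact_mod_cast hEN
  have hlast : 1 / ((E₀ + 1 : ℕ) : ℝ) + Real.log ((N₁ : ℝ) / ((E₀ + 1 : ℕ) : ℝ)) ≤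
      2 * Real.log ((N₁ : ℝ) + 2) := by
    have h1 : 1 / ((E₀ + 1 : ℕ) : ℝ) ≤ 1 := by rw [div_le_one (by linarith)]; exact hE1
    have h2 : (N₁ : ℝ) / ((E₀ + 1 : ℕ) : ℝ) ≤ N₁ := div_le_self hN₁0.le hE1
    have h3 : Real.log ((N₁ : ℝ) / ((E₀ + 1 : ℕ) : ℝ)) ≤ Real.log ((N₁ : ℝ) + 2) :=
      (Real.log_le_log (div_pos hN₁0 (by linarith)) h2).trans
        (Real.log_le_log hN₁0 (by linarith))
    linarith
  have hlast0 : 0 ≤ 1 / ((E₀ + 1 : ℕ) : ℝ) + Real.log ((N₁ : ℝ) / ((E₀ + 1 : ℕ) : ℝ)) := by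
    have h1 : 0 ≤ 1 / ((E₀ + 1 : ℕ) : ℝ) := by positivity
    have h2 : 0 ≤ Real.log ((N₁ : ℝ) / ((E₀ + 1 : ℕ) : ℝ)) :=
      Real.log_nonneg (by rw [le_div_iff₀ (by linarith)]; linarith)
    linarith
  -- assemble
  have hb2 : 0 ≤ 2 + b₁ := by linarith
  have step1 := mul_le_mul hH hMδ (by positivity) (mul_nonneg (by linarith) (by linarith))
  have step2 := mul_le_mul_of_nonneg_right step1 hκθ
  have step3 := mul_le_mul step2 (mul_le_mul_of_nonneg_left hlast hb2)
    (mul_nonneg hb2 hlast0) (mul_nonneg (mul_nonneg (mul_nonneg (by linarith)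
      (by positivity)) (by positivity)) hκθ)
  refine step3.trans ?_
  have hsq : Real.log ((N₁ : ℝ) + 2) ^ 2 ≤ ((2 + a) * Real.log N₀) ^ 2 :=
    pow_le_pow_left₀ (by linarith) hlogM 2
  have hC0 : 0 ≤ (3 + β + 2 * b₁ + B + δ) * 2 ^ (1 + β) * 3 ^ δ * (κ ^ (β + 1) / θ) *
      ((2 + b₁) * 2) * (N₀ : ℝ) ^ ((1 + a) * δ) := by
    have : 0 ≤ 3 + β + 2 * b₁ + B + δ := by linarith
    positivity
  calc (3 + β + 2 * b₁ + B + δ) * Real.log ((N₁ : ℝ) + 2) *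
        (2 ^ (1 + β) * (3 ^ δ * (N₀ : ℝ) ^ ((1 + a) * δ))) * (κ ^ (β + 1) / θ) *
        ((2 + b₁) * (2 * Real.log ((N₁ : ℝ) + 2)))
      = (3 + β + 2 * b₁ + B + δ) * 2 ^ (1 + β) * 3 ^ δ * (κ ^ (β + 1) / θ) *
          ((2 + b₁) * 2) * (N₀ : ℝ) ^ ((1 + a) * δ) * Real.log ((N₁ : ℝ) + 2) ^ 2 := by ring
    _ ≤ (3 + β + 2 * b₁ + B + δ) * 2 ^ (1 + β) * 3 ^ δ * (κ ^ (β + 1) / θ) *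
          ((2 + b₁) * 2) * (N₀ : ℝ) ^ ((1 + a) * δ) * ((2 + a) * Real.log N₀) ^ 2 :=
        mul_le_mul_of_nonneg_left hsq hC0
    _ = _ := by ring

/-- The endgame inequality: for `C ≥ 0`, `c > 0` and `q < p`, eventually in `N₀ : ℕ`,
`C N₀^q (log N₀)² < c N₀^p log N₀` (`log N₀ ≤ N₀^ε / ε`, `ε = (p-q)/2`). -/
theorem soloX_endgame {C c q p : ℝ} (hC : 0 ≤ C) (hc : 0 < c) (hqp : q < p) :
    ∀ᶠ N₀ : ℕ in atTop,
      C * (N₀ : ℝ) ^ q * Real.log N₀ ^ 2 < c * (N₀ : ℝ) ^ p * Real.log N₀ := by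
  obtain ⟨ε, hε, hqε, rfl⟩ : ∃ ε : ℝ, 0 < ε ∧ q + ε < p ∧ ε = (p - q) / 2 :=
    ⟨(p - q) / 2, by linarith, by linarith, rfl⟩
  have hcc : c / 2 * (2 / c) = 1 := by
    rw [div_mul_div_comm, mul_comm c 2, div_self (by positivity)]
  filter_upwards [eventually_const_mul_rpow_le_rpow hqε (C / ((p - q) / 2) * (2 / c)),
    eventually_ge_atTop 2] with N₀ hA hN
  have hN' : (2 : ℝ) ≤ N₀ := by exact_mod_cast hN
  have hN0 : (0 : ℝ) < N₀ := by linarith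
  have hlog0 : 0 < Real.log N₀ := Real.log_pos (by linarith)
  have hlog : Real.log N₀ ≤ (N₀ : ℝ) ^ ((p - q) / 2) / ((p - q) / 2) :=
    Real.log_le_rpow_div hN0.le hε
  have hp0 : 0 < (N₀ : ℝ) ^ p := Real.rpow_pos_of_pos hN0 p
  have h1 : C * (N₀ : ℝ) ^ q * Real.log N₀ ≤
      C * (N₀ : ℝ) ^ q * ((N₀ : ℝ) ^ ((p - q) / 2) / ((p - q) / 2)) :=
    mul_le_mul_of_nonneg_left hlog (by positivity)
  have h2 : C * (N₀ : ℝ) ^ q * ((N₀ : ℝ) ^ ((p - q) / 2) / ((p - q) / 2)) =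
      C / ((p - q) / 2) * (N₀ : ℝ) ^ (q + (p - q) / 2) := by
    rw [Real.rpow_add hN0]; ring
  have h3 : C / ((p - q) / 2) * (N₀ : ℝ) ^ (q + (p - q) / 2) ≤ c / 2 * (N₀ : ℝ) ^ p := by
    have h := mul_le_mul_of_nonneg_left hA (half_pos hc).le
    calc C / ((p - q) / 2) * (N₀ : ℝ) ^ (q + (p - q) / 2)
        = (c / 2 * (2 / c)) * (C / ((p - q) / 2) * (N₀ : ℝ) ^ (q + (p - q) / 2)) := by
          rw [hcc, one_mul]
      _ = c / 2 * (C / ((p - q) / 2) * (2 / c) * (N₀ : ℝ) ^ (q + (p - q) / 2)) := by ring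
      _ ≤ c / 2 * (N₀ : ℝ) ^ p := h
  have h4 : C * (N₀ : ℝ) ^ q * Real.log N₀ < c * (N₀ : ℝ) ^ p := by
    linarith [mul_pos hc hp0]
  calc C * (N₀ : ℝ) ^ q * Real.log N₀ ^ 2
      = (C * (N₀ : ℝ) ^ q * Real.log N₀) * Real.log N₀ := by ring
    _ < (c * (N₀ : ℝ) ^ p) * Real.log N₀ := mul_lt_mul_of_pos_right h4 hlog0
    _ = c * (N₀ : ℝ) ^ p * Real.log N₀ := by ring

end Summit.Schanuel.Schanuel.Theorems
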